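import Summits.HodgeConjecture.CorCM.WeilFaceExceptionalClasses
import Summits.HodgeConjecture.CorCM.WeilLineClassesWeilWeightLines
import Summits.HodgeConjecture.CorCM.Model.ModelAxiomsHolds
import Summits.HodgeConjecture.CorCM.Geometry.BallQuotientUniformisedHolds
import HarnessLib

/-!
# The WHOLE `K`-Weil space `W_K(P(f)) ⊗ ℂ` of a rank-four face product is exotic (unconditional), and for a
# Galois sextic CM field a `6`-dimensional space of ALGEBRAIC classes (given Markman's fourfold theorem)

COR-CM (cell `pub-hodgecm2`), seat b30 gen 12 (2026-08-21); sequel of `CorCM/WeilFaceExceptionalClasses.lean`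
(same seat; split for the 400-line rule); COUNT-NEUTRAL, theorems only, no named fact, no `sorry`.

The carrier of the chain's face hypothesis — seat b07's junction `Model.weilFaceAlgebraic_of_weilLineClasses_le` reads
`U.WeilFaceAlgebraic K f` from `weilLineClasses (cornerAV) (cornerAct) 4 ≤ algebraicClasses _ 2` — is the
`K`-Weil-line space `HodgeTheory.weilLineClasses (A_j) ι 4` of the face product `P(f) = ⨁_j A_j`.  With lit-deligne's
`CorCM/WeilLineClassesWeilWeightLines` (`weilLineClasses = ⨆_s H⁴(P(f))_{4×{s}}`, consumed BY NAME) the line-by-line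
statements of the first file upgrade to statements about the whole space:

* §1 (UNCONDITIONAL; every CM field `K` with `[K:ℚ] ≥ 6`, every face `f : Face K`, every family of realisations of
  the corners): `Face.weilLineClasses_exotic` — `W_K(P(f)) ⊗ ℂ ≠ 0`, it consists of Hodge classes, and it MEETS THE
  DIVISOR RING `D²(P(f)) ⊗ ℂ` TRIVIALLY (`Face.disjoint_weilLineClasses_divisorClassesSpan`,
  `Face.not_weilLineClasses_le_divisorClassesSpan`); `Face.finrank_weilLineClasses_eq` — `dim_ℂ = [K:ℚ]`; the same at
  the model's corner realisations (`Face.weilLineClasses_cornerAV_exotic`); and on the model universe OF RECORD the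
  RATIONAL Weil line `U.weilLine K Φ ⊂ H⁴(P(Φ)(ℂ); ℚ)` has `ℚ`-dimension `[K:ℚ]`, hence is non-zero
  (`Face.picardCMUniverse_finrank_weilLine`, `Face.picardCMUniverse_weilLine_ne_bot` — model axiom `Fact_weilLine_rank`,
  a tree theorem): the per-face hypothesis `U.WeilFaceAlgebraic K f` of `W^{RK4}` quantifies over a non-zero space and
  speaks about classes none of which is a product of divisor classes.
* §2 (Galois SEXTIC `K`, given `Markman2025_weilClasses_algebraic_abelianFourfold` only):
  `CyclicSextic.weilLineClasses_le_algebraicClasses_and_disjoint_of_markman` — `W_K(P(f)) ⊗ ℂ` is a `6`-dimensional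
  space of ALGEBRAIC classes meeting `D²(P(f)) ⊗ ℂ` trivially (seat b30 gen 11's T1
  `weilLineClasses_corner_le_algebraicClasses_of_markman`).

## References
* [Deligne1982HodgeCycles] P. Deligne, *Hodge cycles on abelian varieties*, LNM 900 (1982), I Prop. 4.4, §5 (c).
* [Milne1999LefschetzClasses] J. S. Milne, Duke Math. J. 96 (1999), Example 4.10 ("the Weil classes are exotic").
* [Gordon1999HodgeAVSurvey] B. B. Gordon, *A survey of the Hodge conjecture for abelian varieties*, 9.2.2, §9.3.
* [Milne2020HodgeClassesAV] J. S. Milne, *Hodge classes on abelian varieties* (2020), 1.2 (a).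
* [Markman2025SurveySecant] E. Markman, arXiv:2509.23403, Thm. 1.2.
-/

noncomputable section

open CategoryTheory CategoryTheory.Limits NumberField

namespace Summit.HodgeConjecture.CorCM

open Literature.NumberTheory.ComplexMultiplication
open Literature.AlgebraicGeometry.Motives (AbelianVariety CMType)
open Literature.AlgebraicGeometry.HodgeTheory
open Literature.AlgebraicGeometry.ComplexMultiplication (IsCMTypeRealisation)
open Literature.AlgebraicGeometry.VanGeemen1994 (hodgeClassSpan)
open Literature.AlgebraicGeometry.Pohlmann1968
open Literature.AlgebraicGeometry.Deligne1982
open Literature.Barriers.HodgeConjecture (divisorClassesSpan)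
open Literature.NumberTheory.Automorphic.PicardCM (CMAbelianVarietyRealised)

/-! ## §1 The whole `K`-Weil space of a face product: non-zero, Hodge, disjoint from `D² ⊗ ℂ`, of dimension `[K:ℚ]` -/

namespace Face

section WeilSpace

variable (K : CMField) (h6 : 6 ≤ Module.finrank ℚ K) (f : Face K)
variable {A : Fin (2 * 2) → AbelianVariety ℂ} {ι : ∀ j, 𝓞 K →+* End (A j)}
  {θ : ∀ j, (K : Type) →+* Module.End ℂ (complexBetti (A j).X 1)}

include h6 in
/-- **The `K`-Weil space of a face product is exotic**: `W_K(P(f)) ⊗ ℂ ≠ 0`, it consists of Hodge classes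
(`≤ B²(P(f)) ⊗ ℂ`), and it meets `D²(P(f)) ⊗ ℂ` TRIVIALLY — for every CM field `K` with `[K:ℚ] ≥ 6`, every face `f`
and every family of realisations of its corners. [cite: Milne1999LefschetzClasses, Example 4.10]
[cite: Deligne1982HodgeCycles, I §5 (c) (pp. 38–39)] [cite: Gordon1999HodgeAVSurvey, 9.2.2 and §9.3] -/
theorem weilLineClasses_exotic (hA : ∀ j, IsCMTypeRealisation (f.corner j) (A j) (ι j) (θ j)) :
    weilLineClasses A ι (2 * 2) ≠ ⊥ ∧
      weilLineClasses A ι (2 * 2) ≤ hodgeClassSpan (⨁ A).dim (⨁ A).X 2 ∧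
      Disjoint (weilLineClasses A ι (2 * 2)) (divisorClassesSpan (⨁ A).X (⨁ A).dim 2) :=
  WeilLineWeightLines.weilLineClasses_exotic (Φ := (f.corner : Fin (2 * 2) → CMType K)) hA
    (ncard_mem_corner_eq_two f) (exists_typeCount_corner_ne_of_le K h6 f)

include h6 in
/-- **`W_K(P(f)) ⊗ ℂ ∩ D²(P(f)) ⊗ ℂ = 0`.** [cite: Milne1999LefschetzClasses, Example 4.10]
[cite: Gordon1999HodgeAVSurvey, 9.2.2 and §9.3] -/
theorem disjoint_weilLineClasses_divisorClassesSpan (hA : ∀ j, IsCMTypeRealisation (f.corner j) (A j) (ι j) (θ j)) :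
    Disjoint (weilLineClasses A ι (2 * 2)) (divisorClassesSpan (⨁ A).X (⨁ A).dim 2) :=
  WeilLineWeightLines.disjoint_weilLineClasses_divisorClassesSpan (Φ := (f.corner : Fin (2 * 2) → CMType K)) hA
    (exists_typeCount_corner_ne_of_le K h6 f)

include h6 in
/-- In particular `W_K(P(f)) ⊗ ℂ ⊄ D²(P(f)) ⊗ ℂ`: the face hypothesis `W^{RK4}` is never an instance of the
Lefschetz `(1,1)` theorem with cup products. [cite: Milne1999LefschetzClasses, Example 4.10] -/
theorem not_weilLineClasses_le_divisorClassesSpan (hA : ∀ j, IsCMTypeRealisation (f.corner j) (A j) (ι j) (θ j)) :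
    ¬ weilLineClasses A ι (2 * 2) ≤ divisorClassesSpan (⨁ A).X (⨁ A).dim 2 :=
  WeilLineWeightLines.not_weilLineClasses_le_divisorClassesSpan (Φ := (f.corner : Fin (2 * 2) → CMType K)) hA
    (exists_typeCount_corner_ne_of_le K h6 f)

/-- **`dim_ℂ W_K(P(f)) ⊗ ℂ = [K:ℚ]`** (any CM field, any face, any realisations).
[cite: Deligne1982HodgeCycles, I Prop. 4.4 (p. 30)] [cite: Milne2020HodgeClassesAV, 1.2 (a)] -/
theorem finrank_weilLineClasses_eq (hA : ∀ j, IsCMTypeRealisation (f.corner j) (A j) (ι j) (θ j)) :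
    Module.finrank ℂ ↥(weilLineClasses A ι (2 * 2)) = Module.finrank ℚ K :=
  WeilLineWeightLines.finrank_weilLineClasses_eq (Φ := (f.corner : Fin (2 * 2) → CMType K)) hA (by norm_num)

include h6 in
/-- **At the model's corner realisations** (the carrier of `Model.weilFaceAlgebraic_of_weilLineClasses_le`, with
`h₃ := cmAbelianVarietyRealised_holds`): the `K`-Weil space of `⨁_j A_{(K,Φ_j)}` with the actions `cornerAct` is
non-zero, made of Hodge classes, and disjoint from `D² ⊗ ℂ` — unconditionally. [cite: Milne1999LefschetzClasses, Example 4.10] -/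
theorem weilLineClasses_cornerAV_exotic :
    weilLineClasses (Model.cornerAV cmAbelianVarietyRealised_holds K f.corner : Fin (2 * 2) → AbelianVariety ℂ)
        (Model.cornerAct cmAbelianVarietyRealised_holds K f.corner) (2 * 2) ≠ ⊥ ∧
      weilLineClasses (Model.cornerAV cmAbelianVarietyRealised_holds K f.corner : Fin (2 * 2) → AbelianVariety ℂ)
          (Model.cornerAct cmAbelianVarietyRealised_holds K f.corner) (2 * 2) ≤
        hodgeClassSpan (⨁ (Model.cornerAV cmAbelianVarietyRealised_holds K f.corner :
            Fin (2 * 2) → AbelianVariety ℂ)).dim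
          (⨁ (Model.cornerAV cmAbelianVarietyRealised_holds K f.corner : Fin (2 * 2) → AbelianVariety ℂ)).X 2 ∧
      Disjoint
        (weilLineClasses (Model.cornerAV cmAbelianVarietyRealised_holds K f.corner : Fin (2 * 2) → AbelianVariety ℂ)
          (Model.cornerAct cmAbelianVarietyRealised_holds K f.corner) (2 * 2))
        (divisorClassesSpan
          (⨁ (Model.cornerAV cmAbelianVarietyRealised_holds K f.corner : Fin (2 * 2) → AbelianVariety ℂ)).X
          (⨁ (Model.cornerAV cmAbelianVarietyRealised_holds K f.corner : Fin (2 * 2) → AbelianVariety ℂ)).dim 2) :=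
  weilLineClasses_exotic K h6 f
    (A := (Model.cornerAV cmAbelianVarietyRealised_holds K f.corner : Fin (2 * 2) → AbelianVariety ℂ))
    fun j => Model.cornerAV_isCMTypeRealisation cmAbelianVarietyRealised_holds K f.corner j

end WeilSpace

/-- **The RATIONAL Weil line of the model is non-degenerate**: on the model universe of record
(`Model.picardCMUniverse` at the tree's theorems `exists_isReal_hodgeModel_holds`, `hodgePQ_independent_of_hodgeModel_holds`,
`BallQuotient.ballQuotientUniformised_holds`, `cmAbelianVarietyRealised_holds`), the Weil line
`U.weilLine K Φ ⊂ H⁴(P(Φ)(ℂ); ℚ)` — the rational classes whose complexification lies in the span of the Weil generators —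
has `ℚ`-dimension `[K:ℚ]` for EVERY CM field `K` and every four-slot family `Φ` (model axiom `Fact_weilLine_rank`, a
tree theorem: `Model.picardCMUniverse_modelAxioms`).  So the per-face hypothesis
`U.WeilFaceAlgebraic K f := U.weilLine K f.corner ≤ U.alg (U.prod4 K f.corner) 2` of `W^{RK4}` quantifies over a
NON-ZERO `ℚ`-space (`picardCMUniverse_weilLine_ne_bot`). [cite: Deligne1982HodgeCycles, I Prop. 4.4 (p. 30)] -/
theorem picardCMUniverse_finrank_weilLine (K : CMField) (Φ : Fin 4 → CMType K) :
    Module.finrank ℚ ↥((Model.picardCMUniverse exists_isReal_hodgeModel_holds hodgePQ_independent_of_hodgeModel_holds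
        BallQuotient.ballQuotientUniformised_holds cmAbelianVarietyRealised_holds).weilLine K Φ) =
      Module.finrank ℚ K :=
  (Model.picardCMUniverse_modelAxioms exists_isReal_hodgeModel_holds hodgePQ_independent_of_hodgeModel_holds
    BallQuotient.ballQuotientUniformised_holds cmAbelianVarietyRealised_holds).weilLine_rank K Φ

/-- **`U.weilLine K Φ ≠ 0` on the model universe of record** (every CM field, every four-slot family; in particular
at `Φ = f.corner` for every face `f`). [cite: Deligne1982HodgeCycles, I Prop. 4.4 (p. 30)] -/
theorem picardCMUniverse_weilLine_ne_bot (K : CMField) (Φ : Fin 4 → CMType K) :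
    (Model.picardCMUniverse exists_isReal_hodgeModel_holds hodgePQ_independent_of_hodgeModel_holds
        BallQuotient.ballQuotientUniformised_holds cmAbelianVarietyRealised_holds).weilLine K Φ ≠ ⊥ := by
  intro h
  have h1 := picardCMUniverse_finrank_weilLine K Φ
  rw [h, finrank_bot] at h1
  exact (Module.finrank_pos (R := ℚ) (M := (K : Type))).ne h1

end Face

/-! ## §2 Galois sextic CM fields, given Markman's fourfold theorem -/

namespace CyclicSextic

/-- **Galois sextic `K`, given Markman's fourfold theorem: `W_K(P(f)) ⊗ ℂ` is a `6`-dimensional space of ALGEBRAIC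
classes meeting the divisor ring `D²(P(f)) ⊗ ℂ` trivially** — for every face `f` and every family of realisations of
its corners (seat b30 gen 11ʼs T1 `weilLineClasses_corner_le_algebraicClasses_of_markman` + §1).
[cite: Markman2025SurveySecant, Thm. 1.2] [cite: Milne1999LefschetzClasses, Example 4.10]
[cite: Deligne1982HodgeCycles, I §5 (c) (pp. 38–39)] -/
theorem weilLineClasses_le_algebraicClasses_and_disjoint_of_markman {K : Type} [Field K] [NumberField K]
    [IsCMField K] [IsGalois ℚ K] (hW4 : Markman2025_weilClasses_algebraic_abelianFourfold)
    (h6 : Module.finrank ℚ K = 6) (f : Face K)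
    {A : Fin (2 * 2) → AbelianVariety ℂ} {ι : ∀ j, 𝓞 K →+* End (A j)}
    {θ : ∀ j, K →+* Module.End ℂ (complexBetti (A j).X 1)}
    (hA : ∀ j, IsCMTypeRealisation (f.corner j) (A j) (ι j) (θ j)) :
    weilLineClasses A ι (2 * 2) ≤ algebraicClasses (⨁ A).X 2 ∧
      Disjoint (weilLineClasses A ι (2 * 2)) (divisorClassesSpan (⨁ A).X (⨁ A).dim 2) ∧
      Module.finrank ℂ ↥(weilLineClasses A ι (2 * 2)) = 6 :=
  ⟨weilLineClasses_corner_le_algebraicClasses_of_markman hW4 deligneMilne1982_Thm_6_20_full_holds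
      cmAbelianVarietyRealised_holds h6 f hA,
    Face.disjoint_weilLineClasses_divisorClassesSpan ⟨K⟩ (le_of_eq h6.symm) f hA,
    (Face.finrank_weilLineClasses_eq ⟨K⟩ f hA).trans h6⟩

end CyclicSextic

end Summit.HodgeConjecture.CorCM

end
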